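import Literature.NumberTheory.EllipticCurves.ModularCurveEisensteinCoordinates
import Literature.NumberTheory.EllipticCurves.ModularCurveEllipticPointsProofs
import Literature.NumberTheory.EllipticCurves.ModularCurveGamma0IndexProofs
import Literature.NumberTheory.DiophantineGeometry.FunctionFieldResidues
import Literature.NumberTheory.DiophantineGeometry.FunctionFieldDivisorsNegativeDegreeProofs
import HarnessLib

/-!
# The places of `K_N/ℂ` over `j = j₀` are the points of `Y₀(N)` over `j₀`; `[K_N : ℂ(j)] = μ`

Topic `NumberTheory/EllipticCurves` (the modular function field `K_N = ℂ(X₀(N))` of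
`ModularFunctionField.lean` as an algebraic function field of one variable over `ℂ`; second file of
the "canonical model of `X₀(N)` at CM points" chain).  For `τ₀ ∈ ℍ` with `j(τ₀) = j₀` the zeros of
`j − j₀ ∈ K_N` on `ℍ` are the points `g⁻¹τ₀`, `g ∈ SL₂(ℤ)`; they fall into finitely many
`Γ₀(N)`-orbits, indexed by the double cosets `Stab(τ₀)∖SL₂(ℤ)/Γ₀(N)`, and the orbit of `g⁻¹τ₀`
carries the place `P_{g⁻¹τ₀}` (`pointPlace`) at which `j − j₀` has normalised order
`e = |Stab_{PSL₂(ℤ)}(τ₀)| / |Stab_{Γ̄₀(N)}(g⁻¹τ₀)|` — which is also the number of cosets `gΓ₀(N)` in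
the double coset.  Hence **`∑_{orbits} e = [SL₂(ℤ) : Γ₀(N)] = μ`** (`sum_ord_placesOver`).  Since
`∑ e_P deg P ≤ [K_N : ℂ(j)]` over any finite set of zeros (Stichtenoth Prop. 1.3.3, the tree's
`sum_ord_mul_degree_le_finrank_int`) and `[K_N : ℂ(j)] ≤ μ` (the tree's degree bound
`natDegree_minpoly_ratFuncJ_le` with a primitive element), we get:

* `finrank_ratFuncJ` — **`[K_N : ℂ(j)] = μ`** (Shimura 1971, Prop. 2.11; Diamond–Shurman §7.5);
* `mem_placesOver_of_ord_pos` — **completeness of the fibres of `j`**: every place of `K_N/ℂ` at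
  which `j − j₀` has positive order is one of the `P_{g⁻¹τ₀}` (the input "every place of `K_N` over
  `j₀` is one of them" asked for in `DiophantineGeometry/FunctionFieldResidues.lean` for the genus of
  `X₀(N)`);
* `exists_eq_pointPlace` — every place of `K_N/ℂ` at which `j` is finite is `P_τ` for some `τ ∈ ℍ`:
  **the finite places of `K_N` are the points of `Y₀(N)`** (Diamond–Shurman §7.5; Shimura §1.8/§2.4).

Everything is proved; `placeOfCoset`, `placesOver` are auxiliary definitions (no named facts).

## References

* G. Shimura, *Introduction to the arithmetic theory of automorphic functions*, 1971, Prop. 1.37,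
  §2.4, Prop. 2.11. [ShimuraIATAF1971]
* F. Diamond, J. Shurman, *A First Course in Modular Forms*, GTM 228, 2005, §2.3–2.4, §3.1, §7.5.
  [DiamondShurman2005]
* H. Stichtenoth, *Algebraic Function Fields and Codes*, 2nd ed., GTM 254, 2009, Prop. 1.3.3,
  Thm. 1.4.11. [Stichtenoth2009]
-/

noncomputable section

open scoped MatrixGroups ModularForm Modular Classical IntermediateField
open CongruenceSubgroup Matrix.SpecialLinearGroup ModularGroup ModularForm EisensteinSeries
open UpperHalfPlane hiding I
open Literature.NumberTheory.DiophantineGeometry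
open Literature.NumberTheory.DiophantineGeometry.AlgFunctionField

namespace Literature.NumberTheory.EllipticCurves.ModularForms

variable {N : ℕ} [NeZero N]

/-! ### `[K_N : ℂ(j)] ≤ μ` and finiteness -/

/-- `K_N` is finite over `ℂ(j)` (an algebraic function field is finite over the field generated by a
transcendental element; the tree's `IsAlgFunctionField.finiteDimensional_adjoin_simple`). [folklore] -/
instance finiteDimensional_ratFuncJ : FiniteDimensional (ratFuncJ N) (modularFunctionField N) :=
  IsAlgFunctionField.finiteDimensional_adjoin_simple transcendental_kleinJK

/-- **`[K_N : ℂ(j)] ≤ μ = [SL₂(ℤ) : Γ₀(N)]`**: `K_N = ℂ(j)(u₀)` for a primitive element `u₀`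
(`exists_ratFuncJ_adjoin_eq_top`) whose minimal polynomial over `ℂ(j)` has degree `≤ μ`
(`natDegree_minpoly_ratFuncJ_le`; Shimura 1971, Prop. 2.11). [cite: ShimuraIATAF1971, Prop. 2.11] -/
theorem finrank_ratFuncJ_le : Module.finrank (ratFuncJ N) (modularFunctionField N) ≤ gamma0Index N := by
  obtain ⟨u₀, hu₀⟩ := exists_ratFuncJ_adjoin_eq_top (N := N)
  have hint : IsIntegral (ratFuncJ N) u₀ := (natDegree_minpoly_ratFuncJ_le u₀).1.isIntegral
  have h1 := IntermediateField.adjoin.finrank hint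
  rw [hu₀, IntermediateField.finrank_top'] at h1
  rw [h1]
  exact (natDegree_minpoly_ratFuncJ_le u₀).2

/-! ### The period of `SL₂(ℤ)` at `τ` in terms of `E₄`, `E₆` -/

/-- The period of `τ` for the full modular group: `3` on the orbit of `ρ` (`E₄(τ) = 0`), `2` on the
orbit of `i` (`E₆(τ) = 0`), `1` elsewhere (Diamond–Shurman §2.3; Serre VII §3.2). [folklore] -/
theorem ellipticPeriod_top (τ : ℍ) :
    ellipticPeriod ⊤ τ = if E₄ τ = 0 then 3 else if E₆ τ = 0 then 2 else 1 := by
  by_cases h4 : E₄ τ = 0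
  · obtain ⟨γ, rfl⟩ := E₄_eq_zero_iff.mp h4
    rw [if_pos h4, ellipticPeriod_smul_ρ, if_pos (le_adjoinNegI (Subgroup.mem_top _))]
  by_cases h6 : E₆ τ = 0
  · obtain ⟨γ, rfl⟩ := E₆_eq_zero_iff.mp h6
    rw [if_neg h4, if_pos h6, ellipticPeriod_smul_I, if_pos (le_adjoinNegI (Subgroup.mem_top _))]
  rw [if_neg h4, if_neg h6]
  rcases ellipticPeriod_trichotomy (Γ := ⊤) τ with ⟨k, rfl⟩ | ⟨k, rfl⟩ | h1
  · exact absurd (E₆_eq_zero_iff.mpr ⟨k, rfl⟩) h6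
  · exact absurd (E₄_eq_zero_iff.mpr ⟨k, rfl⟩) h4
  · exact h1

omit [NeZero N] in
/-- `ord_τ(j − j₀) = |Stab_{PSL₂(ℤ)}(τ)|` at every point `τ` over `j₀` (`j − j₀ = j − j(τ)` there; the
tree's `ordAt_kleinJSub` with `ellipticPeriod_top`). [folklore] -/
theorem ordAt_kleinJSub_eq_ellipticPeriod_top {τ₀ τ : ℍ} (h : kleinJ τ = kleinJ τ₀) :
    ordAt τ (kleinJSub N τ₀) = ellipticPeriod ⊤ τ := by
  have : kleinJSub N τ₀ = kleinJSub N τ := by rw [kleinJSub_eq, kleinJSub_eq, h]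
  rw [this, ordAt_kleinJSub, ellipticPeriod_top]
  split_ifs <;> rfl

/-! ### The places over `j₀` attached to the cosets `SL₂(ℤ)/Γ₀(N)` -/

section PlacesOver

/-- The quotient `SL₂(ℤ)/Γ₀(N)` is finite, of cardinality `μ`. [folklore] -/
instance fintypeQuotientGamma0 : Fintype (SL(2, ℤ) ⧸ Gamma0 N) := Subgroup.fintypeQuotientOfFiniteIndex

variable (N)

/-- The place `P_{g⁻¹τ₀}` attached to the coset `gΓ₀(N)` (well defined: `(gγ)⁻¹τ₀ = γ⁻¹(g⁻¹τ₀)` and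
`pointPlace_smul_of_mem`); these are the places of `K_N` at the points of `Y₀(N)` over `j(τ₀)`.
[folklore] -/
def placeOfCoset (τ₀ : ℍ) : SL(2, ℤ) ⧸ Gamma0 N → PlaceOver ℂ (modularFunctionField N) :=
  Quotient.lift (fun g : SL(2, ℤ) ↦ pointPlace (N := N) (g⁻¹ • τ₀)) fun a b hab ↦ by
    replace hab : a⁻¹ * b ∈ Gamma0 N := QuotientGroup.leftRel_apply.mp hab
    have ha : a⁻¹ • τ₀ = (a⁻¹ * b) • b⁻¹ • τ₀ := by rw [← mul_smul, mul_inv_cancel_right]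
    change pointPlace (a⁻¹ • τ₀) = pointPlace (b⁻¹ • τ₀)
    rw [ha]
    exact pointPlace_smul_of_mem hab _

/-- Unfolding of `placeOfCoset` on a representative. [folklore] -/
@[simp] theorem placeOfCoset_mk (τ₀ : ℍ) (g : SL(2, ℤ)) :
    placeOfCoset N τ₀ (g : SL(2, ℤ) ⧸ Gamma0 N) = pointPlace (N := N) (g⁻¹ • τ₀) := rfl

/-- The finite set of places of `K_N` at the points of `Y₀(N)` over `j(τ₀)`. [folklore] -/
def placesOver (τ₀ : ℍ) : Finset (PlaceOver ℂ (modularFunctionField N)) :=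
  Finset.univ.image (placeOfCoset N τ₀)

variable {N}

/-- Membership in `placesOver`. [folklore] -/
theorem mem_placesOver_iff {τ₀ : ℍ} {P : PlaceOver ℂ (modularFunctionField N)} :
    P ∈ placesOver N τ₀ ↔ ∃ g : SL(2, ℤ), pointPlace (N := N) (g⁻¹ • τ₀) = P := by
  rw [placesOver, Finset.mem_image]
  constructor
  · rintro ⟨c, -, rfl⟩
    induction c using QuotientGroup.induction_on with | H g => exact ⟨g, rfl⟩
  · rintro ⟨g, rfl⟩
    exact ⟨g, Finset.mem_univ _, rfl⟩

/-- `P_{τ₀}` itself is over `j(τ₀)`. [folklore] -/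
theorem pointPlace_mem_placesOver (τ₀ : ℍ) : pointPlace (N := N) τ₀ ∈ placesOver N τ₀ :=
  mem_placesOver_iff.mpr ⟨1, by rw [inv_one, one_smul]⟩

/-- **Two cosets carry the same place iff they differ by the stabiliser of `τ₀`**: `P_{g'⁻¹τ₀} =
P_{g⁻¹τ₀}` iff `g'Γ₀(N) = s·gΓ₀(N)` for some `s ∈ SL₂(ℤ)` with `sτ₀ = τ₀` (`pointPlace_eq_iff`).
[folklore] -/
theorem placeOfCoset_eq_iff {τ₀ : ℍ} (g g' : SL(2, ℤ)) :
    placeOfCoset N τ₀ (g' : SL(2, ℤ) ⧸ Gamma0 N) = placeOfCoset N τ₀ g ↔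
      ∃ s : SL(2, ℤ), s • τ₀ = τ₀ ∧ ((s * g : SL(2, ℤ)) : SL(2, ℤ) ⧸ Gamma0 N) = g' := by
  rw [placeOfCoset_mk, placeOfCoset_mk, pointPlace_eq_iff]
  constructor
  · rintro ⟨γ, hγ⟩
    refine ⟨g' * (γ : SL(2, ℤ))⁻¹ * g⁻¹, ?_, ?_⟩
    · -- `(g γ g'⁻¹) τ₀ = τ₀`, hence its inverse fixes `τ₀`
      have h1 : (g * (γ : SL(2, ℤ)) * g'⁻¹) • τ₀ = τ₀ := by
        rw [mul_smul, mul_smul, hγ, smul_inv_smul]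
      have : g' * (γ : SL(2, ℤ))⁻¹ * g⁻¹ = (g * (γ : SL(2, ℤ)) * g'⁻¹)⁻¹ := by group
      rw [this, inv_smul_eq_iff, h1]
    · rw [QuotientGroup.eq]
      have : (g' * (γ : SL(2, ℤ))⁻¹ * g⁻¹ * g)⁻¹ * g' = γ := by group
      rw [this]
      exact γ.2
  · rintro ⟨s, hs, hsg⟩
    rw [QuotientGroup.eq] at hsg
    refine ⟨⟨(s * g)⁻¹ * g', hsg⟩, ?_⟩
    change ((s * g)⁻¹ * g') • g'⁻¹ • τ₀ = g⁻¹ • τ₀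
    rw [← mul_smul, mul_assoc, mul_inv_cancel, mul_one, mul_inv_rev, mul_smul]
    congr 1
    rw [inv_smul_eq_iff, hs]

/-- The order of `j − j(τ₀)` at the place of the coset `gΓ₀(N)`, times the period of `g⁻¹τ₀` for
`Γ₀(N)`, is the period of `τ₀` for `SL₂(ℤ)`: `e_P · h_{Γ₀(N)}(g⁻¹τ₀) = h_{SL₂(ℤ)}(τ₀)`
(`ord_pointPlace`, `ordAtN_mul_ellipticPeriod`, `ordAt_kleinJSub`). [folklore] -/
theorem ord_placeOfCoset_mul (τ₀ : ℍ) (g : SL(2, ℤ)) :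
    (placeOfCoset N τ₀ g).ord (kleinJSub N τ₀) * ellipticPeriod (Gamma0 N) (g⁻¹ • τ₀) =
      ellipticPeriod ⊤ τ₀ := by
  rw [placeOfCoset_mk, ord_pointPlace _ (kleinJSub_ne_zero τ₀), ordAtN_mul_ellipticPeriod,
    ordAt_kleinJSub_eq_ellipticPeriod_top (kleinJ_smul g⁻¹ τ₀)]
  exact_mod_cast ellipticPeriod_smul_of_mem ⊤ (le_adjoinNegI (Subgroup.mem_top g⁻¹)) τ₀

/-- The order of `j − j(τ₀)` at a place over `j(τ₀)` is positive. [folklore] -/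
theorem ord_pos_of_mem_placesOver {τ₀ : ℍ} {P : PlaceOver ℂ (modularFunctionField N)}
    (hP : P ∈ placesOver N τ₀) : 0 < P.ord (kleinJSub N τ₀) := by
  obtain ⟨g, rfl⟩ := mem_placesOver_iff.mp hP
  have h := ord_placeOfCoset_mul (N := N) τ₀ g
  rw [placeOfCoset_mk] at h
  have hp : (0 : ℤ) < ellipticPeriod (Gamma0 N) (g⁻¹ • τ₀) := ellipticPeriod_cast_pos _
  have hs : (0 : ℤ) < ellipticPeriod ⊤ τ₀ := by exact_mod_cast ellipticPeriod_pos ⊤ τ₀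
  rw [← h] at hs
  exact pos_of_mul_pos_left hs hp.le

end PlacesOver

/-! ### Counting: `∑_{P over j₀} ord_P(j − j₀) = μ` -/

section Count

/-- The stabiliser of `τ₀` in `SL₂(ℤ)` is finite, of order `2 h_{SL₂(ℤ)}(τ₀)`. [folklore] -/
theorem natCard_stabilizer_eq (τ₀ : ℍ) :
    Nat.card (MulAction.stabilizer SL(2, ℤ) τ₀) = 2 * ellipticPeriod ⊤ τ₀ := by
  rw [two_mul_ellipticPeriod, card_stabilizer_adjoinNegI]
  exact Nat.card_congr
    { toFun := fun g ↦ ⟨g.1, le_adjoinNegI (Subgroup.mem_top _), g.2⟩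
      invFun := fun g ↦ ⟨g.1, g.2.2⟩
      left_inv := fun _ ↦ rfl
      right_inv := fun _ ↦ rfl }

/-- Finiteness of the stabiliser of `τ₀` in `SL₂(ℤ)`. [folklore] -/
instance finite_stabilizer_SL (τ₀ : ℍ) : Finite (MulAction.stabilizer SL(2, ℤ) τ₀) := by
  have hpos : 0 < Nat.card (MulAction.stabilizer SL(2, ℤ) τ₀) := by
    rw [natCard_stabilizer_eq]
    have := ellipticPeriod_pos ⊤ τ₀
    omega
  exact (Nat.card_pos_iff.mp hpos).2

omit [NeZero N] in
/-- `|{x ∈ gΓ₀(N)g⁻¹ : xτ₀ = τ₀}| = 2 h_{Γ₀(N)}(g⁻¹τ₀)` (conjugation, `card_stabilizer_smul`). [folklore] -/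
theorem natCard_stabilizer_conj (τ₀ : ℍ) (g : SL(2, ℤ)) :
    Nat.card {x : SL(2, ℤ) // g⁻¹ * x * g ∈ Gamma0 N ∧ x • τ₀ = τ₀} =
      2 * ellipticPeriod (Gamma0 N) (g⁻¹ • τ₀) := by
  rw [two_mul_ellipticPeriod, card_stabilizer_adjoinNegI, card_stabilizer_smul, adjoinNegI_gamma0]
  simp only [inv_inv]

/-- **The fibre of `gΓ₀(N) ↦ P_{g⁻¹τ₀}` through `gΓ₀(N)` has `h_{SL₂(ℤ)}(τ₀)/h_{Γ₀(N)}(g⁻¹τ₀)` elements**: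
it is the orbit of `gΓ₀(N)` under the stabiliser of `τ₀` (`placeOfCoset_eq_iff`), whose isotropy group
is `Stab(τ₀) ∩ gΓ₀(N)g⁻¹ ≅ Stab_{Γ₀(N)}(g⁻¹τ₀)` (double coset counting, Shimura Prop. 1.37;
Diamond–Shurman §3.1). [cite: DiamondShurman2005, §3.1] -/
theorem card_fiber_placeOfCoset_mul (τ₀ : ℍ) (g : SL(2, ℤ)) :
    (Finset.univ.filter fun c : SL(2, ℤ) ⧸ Gamma0 N ↦
        placeOfCoset N τ₀ c = placeOfCoset N τ₀ g).card * ellipticPeriod (Gamma0 N) (g⁻¹ • τ₀) =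
      ellipticPeriod ⊤ τ₀ := by
  classical
  set S := MulAction.stabilizer SL(2, ℤ) τ₀ with hS_def
  haveI : Fintype S := Fintype.ofFinite S
  -- the map `s ↦ sgΓ₀(N)` on the stabiliser
  set f : S → SL(2, ℤ) ⧸ Gamma0 N := fun s ↦ ((s : SL(2, ℤ)) * g : SL(2, ℤ)) with hf_def
  -- its image is the fibre
  have himage : Finset.univ.image f =
      Finset.univ.filter fun c : SL(2, ℤ) ⧸ Gamma0 N ↦ placeOfCoset N τ₀ c = placeOfCoset N τ₀ g := by
    ext c
    simp only [Finset.mem_image, Finset.mem_univ, true_and, Finset.mem_filter]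
    constructor
    · rintro ⟨s, rfl⟩
      exact (placeOfCoset_eq_iff g _).mpr ⟨s, s.2, rfl⟩
    · intro hc
      induction c using QuotientGroup.induction_on with
      | H g' =>
        obtain ⟨s, hs, hsg⟩ := (placeOfCoset_eq_iff g g').mp hc
        exact ⟨⟨s, hs⟩, hsg⟩
  -- the fibres of `f` are cosets of `H = {s : g⁻¹sg ∈ Γ₀(N)}`
  have hfib : ∀ s₀ : S, (Finset.univ.filter fun s : S ↦ f s = f s₀).card =
      2 * ellipticPeriod (Gamma0 N) (g⁻¹ • τ₀) := by
    intro s₀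
    rw [← natCard_stabilizer_conj τ₀ g, ← Nat.card_eq_finsetCard]
    refine Nat.card_congr
      { toFun := fun s ↦ ⟨(s₀ : SL(2, ℤ))⁻¹ * (s.1 : SL(2, ℤ)), ?_, ?_⟩
        invFun := fun x ↦ ⟨⟨(s₀ : SL(2, ℤ)) * x.1, ?_⟩, ?_⟩
        left_inv := fun s ↦ by ext; simp
        right_inv := fun x ↦ by ext; simp }
    · have h := (Finset.mem_filter.mp s.2).2
      change ((((s.1 : S) : SL(2, ℤ)) * g : SL(2, ℤ)) : SL(2, ℤ) ⧸ Gamma0 N) =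
        (((s₀ : SL(2, ℤ)) * g : SL(2, ℤ)) : SL(2, ℤ) ⧸ Gamma0 N) at h
      rw [QuotientGroup.eq] at h
      -- `(s g)⁻¹ (s₀ g) ∈ Γ`; we need `g⁻¹ (s₀⁻¹ s) g ∈ Γ`, its inverse
      have h' := inv_mem h
      convert h' using 1
      group
    · rw [mul_smul, s.1.2, inv_smul_eq_iff, s₀.2]
    · change ((s₀ : SL(2, ℤ)) * x.1) • τ₀ = τ₀
      rw [mul_smul, x.2.2, s₀.2]
    · rw [Finset.mem_filter, hf_def]
      refine ⟨Finset.mem_univ _, ?_⟩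
      simp only
      rw [QuotientGroup.eq]
      have h' := inv_mem x.2.1
      convert h' using 1
      group
  -- count
  have hcount : Fintype.card S =
      (Finset.univ.filter fun c : SL(2, ℤ) ⧸ Gamma0 N ↦
        placeOfCoset N τ₀ c = placeOfCoset N τ₀ g).card * (2 * ellipticPeriod (Gamma0 N) (g⁻¹ • τ₀)) := by
    rw [← himage, ← Finset.card_univ, Finset.card_eq_sum_card_image f Finset.univ]
    rw [Finset.sum_const_nat (m := 2 * ellipticPeriod (Gamma0 N) (g⁻¹ • τ₀))]
    · intro c hc
      obtain ⟨s₀, -, rfl⟩ := Finset.mem_image.mp hc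
      exact hfib s₀
  have hS : Fintype.card S = 2 * ellipticPeriod ⊤ τ₀ := by
    rw [Fintype.card_eq_nat_card, natCard_stabilizer_eq]
  rw [hS] at hcount
  have h2 : 2 * ((Finset.univ.filter fun c : SL(2, ℤ) ⧸ Gamma0 N ↦
      placeOfCoset N τ₀ c = placeOfCoset N τ₀ g).card * ellipticPeriod (Gamma0 N) (g⁻¹ • τ₀)) =
      2 * ellipticPeriod ⊤ τ₀ := by rw [hcount]; ring
  omega

/-- The order of `j − j(τ₀)` at the place of `gΓ₀(N)` **equals** the size of the fibre through
`gΓ₀(N)`. [folklore] -/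
theorem ord_placeOfCoset_eq_card (τ₀ : ℍ) (g : SL(2, ℤ)) :
    (placeOfCoset N τ₀ g).ord (kleinJSub N τ₀) =
      (Finset.univ.filter fun c : SL(2, ℤ) ⧸ Gamma0 N ↦
        placeOfCoset N τ₀ c = placeOfCoset N τ₀ g).card := by
  have h1 := ord_placeOfCoset_mul (N := N) τ₀ g
  have h2 := card_fiber_placeOfCoset_mul (N := N) τ₀ g
  have hp : (0 : ℤ) < ellipticPeriod (Gamma0 N) (g⁻¹ • τ₀) := ellipticPeriod_cast_pos _
  have h2' : ((Finset.univ.filter fun c : SL(2, ℤ) ⧸ Gamma0 N ↦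
        placeOfCoset N τ₀ c = placeOfCoset N τ₀ g).card : ℤ) * ellipticPeriod (Gamma0 N) (g⁻¹ • τ₀) =
      ellipticPeriod ⊤ τ₀ := by exact_mod_cast h2
  exact mul_right_cancel₀ hp.ne' (h1.trans h2'.symm)

/-- **`∑_{P over j₀} ord_P(j − j₀) = μ = [SL₂(ℤ) : Γ₀(N)]`** — the degree of the divisor of zeros of
`j − j₀` supported on the points of `Y₀(N)` (Shimura Prop. 1.37 / §2.4; Diamond–Shurman §3.1: the
degree of `X₀(N) → X(1)` computed on a fibre, `∑ e = d`). [cite: ShimuraIATAF1971, §2.4] -/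
theorem sum_ord_placesOver (τ₀ : ℍ) :
    ∑ P ∈ placesOver N τ₀, P.ord (kleinJSub N τ₀) = gamma0Index N := by
  classical
  -- `#(SL₂(ℤ)/Γ₀(N)) = μ` (the tree's `index_gamma0_eq_gamma0Index_holds`; cf. `card_quotient_eq`)
  have hcard : Fintype.card (SL(2, ℤ) ⧸ Gamma0 N) = gamma0Index N := by
    rw [Fintype.card_eq_nat_card, ← Subgroup.index_eq_card]
    exact index_gamma0_eq_gamma0Index_holds N
  rw [← hcard, ← Finset.card_univ,
    Finset.card_eq_sum_card_image (placeOfCoset N τ₀) Finset.univ, placesOver, Nat.cast_sum]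
  refine Finset.sum_congr rfl fun P hP ↦ ?_
  obtain ⟨c, -, rfl⟩ := Finset.mem_image.mp hP
  induction c using QuotientGroup.induction_on with
  | H g => rw [ord_placeOfCoset_eq_card]

end Count

/-! ### Completeness of the fibres and `[K_N : ℂ(j)] = μ` -/

section Completeness

omit [NeZero N] in
/-- `ℂ(j − j₀) = ℂ(j)`. [folklore] -/
theorem adjoin_kleinJSub_eq (τ₀ : ℍ) : ℂ⟮kleinJSub N τ₀⟯ = ratFuncJ N := by
  rw [kleinJSub_eq]
  apply le_antisymm
  · rw [IntermediateField.adjoin_simple_le_iff]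
    exact sub_mem (IntermediateField.mem_adjoin_simple_self ℂ _) (IntermediateField.algebraMap_mem _ _)
  · rw [IntermediateField.adjoin_simple_le_iff]
    have h := add_mem (IntermediateField.mem_adjoin_simple_self ℂ
      (kleinJK N - algebraMap ℂ (modularFunctionField N) (kleinJ τ₀)))
      (IntermediateField.algebraMap_mem
        ℂ⟮kleinJK N - algebraMap ℂ (modularFunctionField N) (kleinJ τ₀)⟯ (kleinJ τ₀))
    rwa [sub_add_cancel] at h

omit [NeZero N] in
/-- `j − j₀` is transcendental over `ℂ`. [folklore] -/
theorem transcendental_kleinJSub (τ₀ : ℍ) : Transcendental ℂ (kleinJSub N τ₀) := by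
  intro halg
  apply transcendental_kleinJK (N := N)
  have h := halg.add (isAlgebraic_algebraMap (R := ℂ) (A := modularFunctionField N) (kleinJ τ₀))
  rwa [kleinJSub_eq, sub_add_cancel] at h

omit [NeZero N] in
/-- `[K_N : ℂ(j − j₀)] = [K_N : ℂ(j)]`. [folklore] -/
theorem finrank_adjoin_kleinJSub (τ₀ : ℍ) :
    Module.finrank ℂ⟮kleinJSub N τ₀⟯ (modularFunctionField N) =
      Module.finrank (ratFuncJ N) (modularFunctionField N) :=
  Algebra.finrank_eq_of_equiv_equiv (IntermediateField.equivOfEq (adjoin_kleinJSub_eq τ₀)).toRingEquiv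
    (RingEquiv.refl _) (by ext x; rfl)

/-- Every place of `K_N/ℂ` has degree one (`ℂ` is algebraically closed; the tree's
`PlaceOver.isRational_of_isAlgClosed`). [folklore] -/
theorem degree_eq_one (P : PlaceOver ℂ (modularFunctionField N)) : P.degree = 1 :=
  PlaceOver.isRational_of_isAlgClosed P

/-- **Completeness of the fibres of `j`**: every place of `K_N/ℂ` at which `j − j(τ₀)` has positive
order is the place `P_{g⁻¹τ₀}` of a point of `Y₀(N)` over `j(τ₀)`.  Otherwise Stichtenoth's
Prop. 1.3.3 (`∑_{P ∈ T} v_P deg P ≤ [K_N : ℂ(j)]` for any finite set `T` of zeros, the tree's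
`sum_ord_mul_degree_le_finrank_int`) applied to the known places together with the extra one would give
`μ + 1 ≤ [K_N : ℂ(j)] ≤ μ` (`sum_ord_placesOver`, `finrank_ratFuncJ_le`).
[cite: Stichtenoth2009, Prop. 1.3.3] -/
theorem mem_placesOver_of_ord_pos {τ₀ : ℍ} {P : PlaceOver ℂ (modularFunctionField N)}
    (hP : 0 < P.ord (kleinJSub N τ₀)) : P ∈ placesOver N τ₀ := by
  classical
  by_contra hPT
  have hle := sum_ord_mul_degree_le_finrank_int (transcendental_kleinJSub τ₀)
    (insert P (placesOver N τ₀)) (by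
      intro Q hQ
      rcases Finset.mem_insert.mp hQ with rfl | hQ
      · exact hP
      · exact ord_pos_of_mem_placesOver hQ)
  rw [Finset.sum_insert hPT] at hle
  simp only [degree_eq_one, Nat.cast_one, mul_one] at hle
  rw [sum_ord_placesOver, finrank_adjoin_kleinJSub] at hle
  have hfin : (Module.finrank (ratFuncJ N) (modularFunctionField N) : ℤ) ≤ gamma0Index N := by
    exact_mod_cast finrank_ratFuncJ_le
  omega

/-- **`[K_N : ℂ(j)] = μ = [SL₂(ℤ) : Γ₀(N)]`** (Shimura 1971, Prop. 2.11; Diamond–Shurman §7.5,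
`[ℂ(X₀(N)) : ℂ(j)] = deg(X₀(N) → X(1))`): `≤` is the tree's primitive-element bound, `≥` is
Prop. 1.3.3 for the zeros of `j − 1728` at the points of `Y₀(N)` over `1728`, of total multiplicity
`μ` (`sum_ord_placesOver`). [cite: ShimuraIATAF1971, Prop. 2.11] -/
theorem finrank_ratFuncJ : Module.finrank (ratFuncJ N) (modularFunctionField N) = gamma0Index N := by
  classical
  refine le_antisymm finrank_ratFuncJ_le ?_
  have hle := sum_ord_mul_degree_le_finrank_int (transcendental_kleinJSub UpperHalfPlane.I)
    (placesOver N UpperHalfPlane.I) fun Q hQ ↦ ord_pos_of_mem_placesOver hQ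
  simp only [degree_eq_one, Nat.cast_one, mul_one] at hle
  rw [sum_ord_placesOver, finrank_adjoin_kleinJSub] at hle
  exact_mod_cast hle

/-- **The finite places of `K_N/ℂ` are the points of `Y₀(N)`**: every place of `K_N/ℂ` at which `j`
is finite is `P_τ` for some `τ ∈ ℍ` — with value `j₀ = j(P)` (`PlaceOver.value`, it exists as the
place is rational) one has `ord_P(j − j₀) ≥ 1`, and `j₀ = j(τ₀)` for some `τ₀` (`j` is onto,
`kleinJ_surjective`), so the place is over `j(τ₀)` and `mem_placesOver_of_ord_pos` applies
(Diamond–Shurman §7.5; Shimura §2.4). [cite: DiamondShurman2005, §7.5] -/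
theorem exists_eq_pointPlace {P : PlaceOver ℂ (modularFunctionField N)}
    (hj : (kleinJK N : modularFunctionField N) ∈ P.toValuationSubring) :
    ∃ τ : ℍ, P = pointPlace (N := N) τ := by
  set j₀ := P.value (kleinJK N) with hj₀
  obtain ⟨τ₀, hτ₀⟩ := kleinJ_surjective j₀
  have hmem : kleinJK N - algebraMap ℂ (modularFunctionField N) j₀ ∈ P.ball 1 :=
    (PlaceOver.isRational_of_isAlgClosed P).sub_value_mem hj
  have heq : kleinJSub N τ₀ = kleinJK N - algebraMap ℂ (modularFunctionField N) j₀ := by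
    rw [kleinJSub_eq, hτ₀]
  have hord : 0 < P.ord (kleinJSub N τ₀) := by
    have h := (P.mem_ball_iff_le_ord 1 (by rw [← heq]; exact kleinJSub_ne_zero τ₀)).mp hmem
    rw [← heq] at h
    omega
  obtain ⟨g, hg⟩ := mem_placesOver_iff.mp (mem_placesOver_of_ord_pos hord)
  exact ⟨g⁻¹ • τ₀, hg.symm⟩

/-- **The places of `K_N` over `j₀ ∈ ℂ`**, complete list: a place has positive order at `j − j(τ₀)` iff
it is `P_{g⁻¹τ₀}` for some `g ∈ SL₂(ℤ)`. [folklore] -/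
theorem ord_kleinJSub_pos_iff {τ₀ : ℍ} {P : PlaceOver ℂ (modularFunctionField N)} :
    0 < P.ord (kleinJSub N τ₀) ↔ ∃ g : SL(2, ℤ), pointPlace (N := N) (g⁻¹ • τ₀) = P :=
  ⟨fun h ↦ mem_placesOver_iff.mp (mem_placesOver_of_ord_pos h),
    fun h ↦ ord_pos_of_mem_placesOver (mem_placesOver_iff.mpr h)⟩

end Completeness

end Literature.NumberTheory.EllipticCurves.ModularForms

end
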